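import Mathlib
import Summits.NavierStokesRegularity.NavierStokesRegularity.Theorems.EulerZoomLiouvillePowerGaugeEulerLiouvilleVorticitySupportTools
import HarnessLib

/-!
# The `q`-power of the vorticity along classical EULER flows with a MOVING weight — the tools
# (helper of the DSS vorticity-decay stratum of the crux `EulerZoomLiouville.PowerGaugeEulerLiouville`,
# route №10, item stmt-NavierStokesRegularity-19832)

Helper file (theorems only; `--supports stmt-NavierStokesRegularity-19832`). Seat ns-typeII-p3 (cell
ns-regularity-ideate §B, D-0081), rung C2 (discretely self-similar members, NO symmetry) of
`Cruxes/PowerGaugeEulerLiouville/Lines/rungC_window.lean`.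

THE OBJECT. For a classical Euler flow `(u, p)` on `[0, T] × ℝ³`, an exponent `q > 0` and a jointly
smooth scalar weight `Θ(t, y)`, the weighted `q`-enstrophy `J(t) = ∫ Θ(t)² |ω(t)|^q`, `ω = curl u`.
Since `|ω|^q` is not differentiable at the zeros of `ω` for `q < 2`, we regularise:
`W_ε = (|ω|² + ε)^{q/4}` (so `W_ε² = (|ω|² + ε)^{q/2} → |ω|^q`). The vorticity equation
`∂ₜω + Dω[u] = Du[ω]` (tree, `ν = 0`) gives the TRANSPORT IDENTITY WITH SOURCE
`∂ₜW_ε + DW_ε[u] = F_ε := (q/2)(|ω|²+ε)^{q/4−1}⟪ω, Du ω⟫` (`timeDerivWithin_qpow_eq`), and for the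
product `Θ·W_ε` the identity `∂ₜ(ΘW_ε) + D(ΘW_ε)[u] = Θ F_ε + W_ε (∂ₜΘ + DΘ[u])`
(`timeDerivWithin_mul_qpow_eq`). Fed to the abstract cut-off identity with source of the prequel
(`VorticitySupport.integral_cutoff_sq_sub_eq_of_transport_source`) this yields, at fixed `ε > 0` and outer
cut-off radius `R`, the identity `integral_cutoff_weight_qpow_sub_eq`:
`½∫χ_R Θ²(|ω|²+ε)^{q/2} |₀ᵀ = ∫₀ᵀ (½∫Dχ_R[u] Θ²(|ω|²+ε)^{q/2}
  + ∫χ_R [(q/2)Θ²(|ω|²+ε)^{q/2−1}⟪ω,Du ω⟫ + Θ(|ω|²+ε)^{q/2}(∂ₜΘ + DΘ[u])])`.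
The limits `ε → 0`, `R → ∞` are taken in the sequel `…QVorticityLimits.lean`.

In print the weighted `q`-enstrophy with the moving exterior weight is the device of Chae–Tsai,
MRL 21 (2014) Thm 2.2 (DSS Euler profiles, similarity variables, multiplier `Ω|Ω|^{q−2}` on
`{R < |y| < R_j}`); here it is set up in PHYSICAL variables, Eulerian, for arbitrary classical Euler
flows. WHAT THIS IS NOT: not NS, not the crux — calculus identities for classical Euler flows. [folklore]
-/

noncomputable section

-- the summit and its single problem share the name `NavierStokesRegularity` (D-0017 nested layout)
set_option linter.dupNamespace false

open Set Function Filter Topology MeasureTheory Metric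
open scoped NNReal ENNReal InnerProductSpace RealInnerProductSpace

namespace Summit.NavierStokesRegularity.NavierStokesRegularity.Theorems.PowerGaugeEulerLiouville.VorticityDecay

open Literature.Analysis Literature.Analysis.FluidPDE
open Summit.NavierStokesRegularity.NavierStokesRegularity.Theorems.PowerGaugeEulerLiouville.VorticitySupport

/-! ## Pointwise calculus of `r ↦ (r + ε)^a` -/

/-- The scalar function `s ↦ (s + ε)^a` has derivative `a (r+ε)^{a−1}` at every `r` with `r + ε > 0`.
[folklore] -/
theorem hasDerivAt_add_rpow {ε r a : ℝ} (h : 0 < r + ε) :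
    HasDerivAt (fun s : ℝ => (s + ε) ^ a) (a * (r + ε) ^ (a - 1)) r := by
  have h1 : HasDerivAt (fun s : ℝ => s + ε) 1 r := (hasDerivAt_id r).add_const ε
  have h2 := h1.rpow_const (p := a) (Or.inl h.ne')
  simpa using h2

section QPow

variable {T ε q : ℝ} {v : ℝ → (EuclideanSpace ℝ (Fin 3)) → (EuclideanSpace ℝ (Fin 3))}
  {p : ℝ → (EuclideanSpace ℝ (Fin 3)) → ℝ}

/-! ## The regularised `q/2`-power `W_ε = (|ω|² + ε)^{q/4}` -/

/-- `W_ε` is jointly smooth along a jointly smooth field on a time set of unique differentiability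
(`ε > 0`). [folklore] -/
theorem isSmoothSpaceTimeOn_qpow {S : Set ℝ} (hS : UniqueDiffOn ℝ S) (hv : IsSmoothSpaceTimeOn S v)
    (hε : 0 < ε) (q : ℝ) :
    IsSmoothSpaceTimeOn S (fun σ x => (‖curl (v σ) x‖ ^ 2 + ε) ^ (q / 4)) := by
  have hω : IsSmoothSpaceTimeOn S (vorticity v) := hv.isSmoothSpaceTimeOn_vorticity hS
  unfold IsSmoothSpaceTimeOn at hω ⊢
  have h1 := ContDiffOn.norm_sq ℝ hω
  exact ((h1.add contDiffOn_const).rpow_const_of_ne fun z _ => by positivity).congr fun z _ => rfl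

/-- **The transport identity with source for `W_ε = (|ω|²+ε)^{q/4}`**: along a classical EULER flow
(`ν = 0`, `f = 0`) on `[0, T]`, `∂ₜW_ε + DW_ε[u] = (q/2)(|ω|²+ε)^{q/4−1}⟪ω, Du[ω]⟫` pointwise (vorticity
equation `∂ₜω + Dω[u] = Du[ω]`, chain rule). [folklore] -/
theorem timeDerivWithin_qpow_eq (hT : 0 < T) (hv : IsClassicalNSSolutionOn (Icc 0 T) 0 0 v p)
    (hε : 0 < ε) (q : ℝ) {σ : ℝ} (hσ : σ ∈ Icc 0 T) (x : (EuclideanSpace ℝ (Fin 3))) :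
    FluidPDE.timeDerivWithin (Icc 0 T) (fun s y => (‖curl (v s) y‖ ^ 2 + ε) ^ (q / 4)) σ x =
      -(fderiv ℝ (fun y => (‖curl (v σ) y‖ ^ 2 + ε) ^ (q / 4)) x (v σ x)) +
        q / 2 * (‖curl (v σ) x‖ ^ 2 + ε) ^ (q / 4 - 1) *
          ⟪curl (v σ) x, fderiv ℝ (v σ) x (curl (v σ) x)⟫ := by
  have hS : UniqueDiffOn ℝ (Icc 0 T) := uniqueDiffOn_Icc hT
  have hω : IsSmoothSpaceTimeOn (Icc 0 T) (vorticity v) := hv.smooth_velocity.isSmoothSpaceTimeOn_vorticity hS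
  -- the vorticity equation at `ν = 0`
  have hvort := hv.vorticity_eq_of_uniqueDiffOn hS (fun _ _ y => by simp [curl]) hσ x
  simp only [zero_smul, add_zero, convect_apply, vorticity_apply] at hvort
  -- time line of `ω` at `x`
  have hωt : HasDerivWithinAt (fun s => curl (v s) x)
      (FluidPDE.timeDerivWithin (Icc 0 T) (vorticity v) σ x) (Icc 0 T) σ := by
    have := hω.hasDerivWithinAt_timeDerivWithin hS hσ x
    simpa [vorticity_apply] using this
  set ω' : (EuclideanSpace ℝ (Fin 3)) := FluidPDE.timeDerivWithin (Icc 0 T) (vorticity v) σ x with hω'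
  -- time derivative of `r(s) = ‖ω(s,x)‖²`
  have hrt : HasDerivWithinAt (fun s => ‖curl (v s) x‖ ^ 2) (2 * ⟪curl (v σ) x, ω'⟫) (Icc 0 T) σ := by
    have h := hωt.inner ℝ hωt
    have e : ∀ s, ⟪curl (v s) x, curl (v s) x⟫ = ‖curl (v s) x‖ ^ 2 := fun s => real_inner_self_eq_norm_sq _
    simp only [e] at h
    have e2 : ⟪curl (v σ) x, ω'⟫ + ⟪ω', curl (v σ) x⟫ = 2 * ⟪curl (v σ) x, ω'⟫ := by
      rw [real_inner_comm (curl (v σ) x) ω']; ring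
    rw [e2] at h
    exact h
  -- time derivative of `W_ε`
  have hden : 0 < ‖curl (v σ) x‖ ^ 2 + ε := by positivity
  have hWt : HasDerivWithinAt (fun s => (‖curl (v s) x‖ ^ 2 + ε) ^ (q / 4))
      (q / 4 * (‖curl (v σ) x‖ ^ 2 + ε) ^ (q / 4 - 1) * (2 * ⟪curl (v σ) x, ω'⟫)) (Icc 0 T) σ := by
    have h := (hasDerivAt_add_rpow (ε := ε) (a := q / 4) (r := ‖curl (v σ) x‖ ^ 2) hden).comp_hasDerivWithinAt
      σ hrt
    exact h
  have hlhs : FluidPDE.timeDerivWithin (Icc 0 T)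
      (fun s y => (‖curl (v s) y‖ ^ 2 + ε) ^ (q / 4)) σ x =
      q / 4 * (‖curl (v σ) x‖ ^ 2 + ε) ^ (q / 4 - 1) * (2 * ⟪curl (v σ) x, ω'⟫) := by
    rw [timeDerivWithin_apply, hWt.derivWithin (hS σ hσ)]
  -- space derivative of `W_ε`
  have hvs := hv.contDiff_velocity hσ
  have hωs : ContDiff ℝ 1 (curl (v σ)) := contDiff_curl (n := 1) (hvs.of_le (by norm_cast))
  have hωx : HasFDerivAt (curl (v σ)) (fderiv ℝ (curl (v σ)) x) x :=
    ((hωs.differentiable one_ne_zero) x).hasFDerivAt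
  have hrx : HasFDerivAt (fun y => ‖curl (v σ) y‖ ^ 2)
      (2 • (innerSL ℝ (curl (v σ) x)).comp (fderiv ℝ (curl (v σ)) x)) x := hωx.norm_sq
  have hWx : HasFDerivAt (fun y => (‖curl (v σ) y‖ ^ 2 + ε) ^ (q / 4))
      ((q / 4 * (‖curl (v σ) x‖ ^ 2 + ε) ^ (q / 4 - 1)) •
        (2 • (innerSL ℝ (curl (v σ) x)).comp (fderiv ℝ (curl (v σ)) x))) x := by
    have h := (hasDerivAt_add_rpow (ε := ε) (a := q / 4) (r := ‖curl (v σ) x‖ ^ 2) hden).comp_hasFDerivAt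
      x hrx
    exact h
  have hrhs : fderiv ℝ (fun y => (‖curl (v σ) y‖ ^ 2 + ε) ^ (q / 4)) x (v σ x) =
      q / 4 * (‖curl (v σ) x‖ ^ 2 + ε) ^ (q / 4 - 1) *
        (2 * ⟪curl (v σ) x, fderiv ℝ (curl (v σ)) x (v σ x)⟫) := by
    rw [hWx.fderiv]
    simp only [_root_.smul_apply, ContinuousLinearMap.comp_apply, innerSL_apply_apply, smul_eq_mul,
      nsmul_eq_mul, Nat.cast_ofNat]
  rw [hlhs, hrhs]
  -- the vorticity equation: `ω' = -Dω[v] + Dv[ω]`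
  have hω'eq : ω' = -(fderiv ℝ (curl (v σ)) x (v σ x)) + fderiv ℝ (v σ) x (curl (v σ) x) :=
    eq_neg_add_iff_add_eq.2 (by rw [add_comm]; exact hvort)
  rw [hω'eq, inner_add_right, inner_neg_right]
  ring

/-! ## The product `Θ · W_ε` with a jointly smooth weight -/

variable {Θ : ℝ → (EuclideanSpace ℝ (Fin 3)) → ℝ}

/-- **The transport identity with source for `Θ W_ε`**:
`∂ₜ(ΘW_ε) = −D(ΘW_ε)[u] + (Θ F_ε + W_ε(∂ₜΘ + DΘ[u]))`. [folklore] -/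
theorem timeDerivWithin_mul_qpow_eq (hT : 0 < T) (hv : IsClassicalNSSolutionOn (Icc 0 T) 0 0 v p)
    (hΘ : IsSmoothSpaceTimeOn (Icc 0 T) Θ) (hε : 0 < ε) (q : ℝ) {σ : ℝ} (hσ : σ ∈ Icc 0 T)
    (x : (EuclideanSpace ℝ (Fin 3))) :
    FluidPDE.timeDerivWithin (Icc 0 T) (fun s y => Θ s y * (‖curl (v s) y‖ ^ 2 + ε) ^ (q / 4)) σ x =
      -(fderiv ℝ (fun y => Θ σ y * (‖curl (v σ) y‖ ^ 2 + ε) ^ (q / 4)) x (v σ x)) +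
        (Θ σ x * (q / 2 * (‖curl (v σ) x‖ ^ 2 + ε) ^ (q / 4 - 1) *
            ⟪curl (v σ) x, fderiv ℝ (v σ) x (curl (v σ) x)⟫) +
          (‖curl (v σ) x‖ ^ 2 + ε) ^ (q / 4) *
            (FluidPDE.timeDerivWithin (Icc 0 T) Θ σ x + fderiv ℝ (Θ σ) x (v σ x))) := by
  have hS : UniqueDiffOn ℝ (Icc 0 T) := uniqueDiffOn_Icc hT
  have hW := isSmoothSpaceTimeOn_qpow hS hv.smooth_velocity hε q
  -- time derivative of the product
  have hΘt := hΘ.hasDerivWithinAt_timeDerivWithin hS hσ x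
  have hWt := hW.hasDerivWithinAt_timeDerivWithin hS hσ x
  have hprod : HasDerivWithinAt (fun s => Θ s x * (‖curl (v s) x‖ ^ 2 + ε) ^ (q / 4))
      (FluidPDE.timeDerivWithin (Icc 0 T) Θ σ x * (‖curl (v σ) x‖ ^ 2 + ε) ^ (q / 4) +
        Θ σ x * FluidPDE.timeDerivWithin (Icc 0 T) (fun s y => (‖curl (v s) y‖ ^ 2 + ε) ^ (q / 4)) σ x)
      (Icc 0 T) σ := hΘt.mul hWt
  have hlhs : FluidPDE.timeDerivWithin (Icc 0 T)
      (fun s y => Θ s y * (‖curl (v s) y‖ ^ 2 + ε) ^ (q / 4)) σ x =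
      FluidPDE.timeDerivWithin (Icc 0 T) Θ σ x * (‖curl (v σ) x‖ ^ 2 + ε) ^ (q / 4) +
        Θ σ x * FluidPDE.timeDerivWithin (Icc 0 T) (fun s y => (‖curl (v s) y‖ ^ 2 + ε) ^ (q / 4)) σ x := by
    rw [timeDerivWithin_apply, hprod.derivWithin (hS σ hσ)]
  -- space derivative of the product
  have hΘs : ContDiff ℝ 1 (Θ σ) := (hΘ.contDiff_slice hσ).of_le (by norm_cast)
  have hWs : ContDiff ℝ 1 (fun y => (‖curl (v σ) y‖ ^ 2 + ε) ^ (q / 4)) :=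
    (hW.contDiff_slice hσ).of_le (by norm_cast)
  have hΘx : DifferentiableAt ℝ (Θ σ) x := (hΘs.differentiable one_ne_zero) x
  have hWx : DifferentiableAt ℝ (fun y => (‖curl (v σ) y‖ ^ 2 + ε) ^ (q / 4)) x :=
    (hWs.differentiable one_ne_zero) x
  have hrhs : fderiv ℝ (fun y => Θ σ y * (‖curl (v σ) y‖ ^ 2 + ε) ^ (q / 4)) x (v σ x) =
      fderiv ℝ (Θ σ) x (v σ x) * (‖curl (v σ) x‖ ^ 2 + ε) ^ (q / 4) +
        Θ σ x * fderiv ℝ (fun y => (‖curl (v σ) y‖ ^ 2 + ε) ^ (q / 4)) x (v σ x) := by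
    rw [fderiv_fun_mul hΘx hWx]
    simp only [add_apply, smul_apply, smul_eq_mul]
    ring
  rw [hlhs, hrhs, timeDerivWithin_qpow_eq hT hv hε q hσ x]
  ring

/-! ## The cut-off identity at fixed `ε` and outer radius `R` -/

/-- **Cut-off identity for the weighted regularised `q`-enstrophy.** For a classical Euler flow on
`[0, T]` (`T > 0`) with `‖u‖, ‖∇u‖ ≤ B` on `[0, T]`, a jointly smooth weight `Θ`, `ε > 0` and `R > 0`:
`½∫χ_R Θ(T)²(|ω(T)|²+ε)^{q/2} − ½∫χ_R Θ(0)²(|ω(0)|²+ε)^{q/2}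
 = ∫_{σ∈(0,T)} (½∫ Dχ_R[u] Θ²(|ω|²+ε)^{q/2} + ∫ χ_R [(q/2)Θ²(|ω|²+ε)^{q/2−1}⟪ω, Du ω⟫
   + Θ (|ω|²+ε)^{q/2}(∂ₜΘ + DΘ[u])]) dσ`. [folklore] -/
theorem integral_cutoff_weight_qpow_sub_eq (hT : 0 < T) (hv : IsClassicalNSSolutionOn (Icc 0 T) 0 0 v p)
    (hΘ : IsSmoothSpaceTimeOn (Icc 0 T) Θ)
    (hB : ∀ σ ∈ Icc 0 T, ∃ B : ℝ, ∀ y, ‖v σ y‖ ≤ B ∧ ‖fderiv ℝ (v σ) y‖ ≤ B)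
    (hε : 0 < ε) (q : ℝ) {R : ℝ} (hR : 0 < R) :
    2⁻¹ * (∫ x, cutoff R x * (Θ T x ^ 2 * (‖curl (v T) x‖ ^ 2 + ε) ^ (q / 2))) -
      2⁻¹ * (∫ x, cutoff R x * (Θ 0 x ^ 2 * (‖curl (v 0) x‖ ^ 2 + ε) ^ (q / 2))) =
      ∫ σ in Ioo 0 T, (2⁻¹ * (∫ x, fderiv ℝ (cutoff R) x (v σ x) *
          (Θ σ x ^ 2 * (‖curl (v σ) x‖ ^ 2 + ε) ^ (q / 2))) +
        ∫ x, cutoff R x *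
          (q / 2 * Θ σ x ^ 2 * (‖curl (v σ) x‖ ^ 2 + ε) ^ (q / 2 - 1) *
              ⟪curl (v σ) x, fderiv ℝ (v σ) x (curl (v σ) x)⟫ +
            Θ σ x * (‖curl (v σ) x‖ ^ 2 + ε) ^ (q / 2) *
              (FluidPDE.timeDerivWithin (Icc 0 T) Θ σ x + fderiv ℝ (Θ σ) x (v σ x)))) := by
  have hS : UniqueDiffOn ℝ (Icc 0 T) := uniqueDiffOn_Icc hT
  have hW := isSmoothSpaceTimeOn_qpow hS hv.smooth_velocity hε q
  have hΘW : IsSmoothSpaceTimeOn (Icc 0 T) (fun s y => Θ s y * (‖curl (v s) y‖ ^ 2 + ε) ^ (q / 4)) :=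
    hΘ.mul hW
  -- continuity data
  have hωc : ∀ σ ∈ Icc 0 T, Continuous (curl (v σ)) := fun σ hσ =>
    (contDiff_curl (n := 0) ((hv.contDiff_velocity hσ).of_le (by norm_cast))).continuous
  have hAc : ∀ σ ∈ Icc 0 T, Continuous (fun x => fderiv ℝ (v σ) x) := fun σ hσ =>
    (hv.contDiff_velocity hσ).continuous_fderiv (by simp)
  have hvc : ∀ σ ∈ Icc 0 T, Continuous (v σ) := fun σ hσ => (hv.contDiff_velocity hσ).continuous
  have hΘc : ∀ σ ∈ Icc 0 T, Continuous (Θ σ) := fun σ hσ => (hΘ.contDiff_slice hσ).continuous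
  have hΘtc : ∀ σ ∈ Icc 0 T, Continuous (FluidPDE.timeDerivWithin (Icc 0 T) Θ σ) := fun σ hσ =>
    ((hΘ.timeDerivWithin hS).contDiff_slice hσ).continuous
  have hΘxc : ∀ σ ∈ Icc 0 T, Continuous (fun x => fderiv ℝ (Θ σ) x) := fun σ hσ =>
    (hΘ.contDiff_slice hσ).continuous_fderiv (by simp)
  have hrc : ∀ σ ∈ Icc 0 T, ∀ a : ℝ, Continuous (fun x => (‖curl (v σ) x‖ ^ 2 + ε) ^ a) := by
    intro σ hσ a
    exact ((hωc σ hσ).norm.pow 2 |>.add continuous_const).rpow_const fun x =>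
      Or.inl (add_pos_of_nonneg_of_pos (sq_nonneg _) hε).ne'
  -- the abstract identity
  have hid := integral_cutoff_sq_sub_eq_of_transport_source hT hΘW
    (F := fun σ x => Θ σ x * (q / 2 * (‖curl (v σ) x‖ ^ 2 + ε) ^ (q / 4 - 1) *
        ⟪curl (v σ) x, fderiv ℝ (v σ) x (curl (v σ) x)⟫) +
      (‖curl (v σ) x‖ ^ 2 + ε) ^ (q / 4) *
        (FluidPDE.timeDerivWithin (Icc 0 T) Θ σ x + fderiv ℝ (Θ σ) x (v σ x)))
    (fun σ hσ => (hv.contDiff_velocity hσ).of_le (by norm_cast)) (fun σ hσ => hv.divFree σ hσ)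
    (fun σ hσ => ?_) (fun σ hσ x => timeDerivWithin_mul_qpow_eq hT hv hΘ hε q hσ x) hB hR
  swap
  · exact ((hΘc σ hσ).mul ((continuous_const.mul (hrc σ hσ _)).mul
      ((hωc σ hσ).inner ((hAc σ hσ).clm_apply (hωc σ hσ))))).add
      ((hrc σ hσ _).mul ((hΘtc σ hσ).add ((hΘxc σ hσ).clm_apply (hvc σ hσ))))
  -- pointwise rewriting of the squares and of the source term
  have hsq : ∀ σ x, (Θ σ x * (‖curl (v σ) x‖ ^ 2 + ε) ^ (q / 4)) ^ 2 =
      Θ σ x ^ 2 * (‖curl (v σ) x‖ ^ 2 + ε) ^ (q / 2) := by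
    intro σ x
    have hden : 0 < ‖curl (v σ) x‖ ^ 2 + ε := by positivity
    have e : ((‖curl (v σ) x‖ ^ 2 + ε) ^ (q / 4)) ^ 2 = (‖curl (v σ) x‖ ^ 2 + ε) ^ (q / 2) := by
      rw [← Real.rpow_natCast ((‖curl (v σ) x‖ ^ 2 + ε) ^ (q / 4)) 2, ← Real.rpow_mul hden.le]
      congr 1
      push_cast
      ring
    rw [mul_pow, e]
  have hsrc : ∀ σ x, (Θ σ x * (q / 2 * (‖curl (v σ) x‖ ^ 2 + ε) ^ (q / 4 - 1) *
        ⟪curl (v σ) x, fderiv ℝ (v σ) x (curl (v σ) x)⟫) +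
      (‖curl (v σ) x‖ ^ 2 + ε) ^ (q / 4) *
        (FluidPDE.timeDerivWithin (Icc 0 T) Θ σ x + fderiv ℝ (Θ σ) x (v σ x))) *
      (Θ σ x * (‖curl (v σ) x‖ ^ 2 + ε) ^ (q / 4)) =
      q / 2 * Θ σ x ^ 2 * (‖curl (v σ) x‖ ^ 2 + ε) ^ (q / 2 - 1) *
          ⟪curl (v σ) x, fderiv ℝ (v σ) x (curl (v σ) x)⟫ +
        Θ σ x * (‖curl (v σ) x‖ ^ 2 + ε) ^ (q / 2) *
          (FluidPDE.timeDerivWithin (Icc 0 T) Θ σ x + fderiv ℝ (Θ σ) x (v σ x)) := by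
    intro σ x
    have hden : 0 < ‖curl (v σ) x‖ ^ 2 + ε := by positivity
    have e1 : (‖curl (v σ) x‖ ^ 2 + ε) ^ (q / 4 - 1) * (‖curl (v σ) x‖ ^ 2 + ε) ^ (q / 4) =
        (‖curl (v σ) x‖ ^ 2 + ε) ^ (q / 2 - 1) := by
      rw [← Real.rpow_add hden]; ring_nf
    have e2 : (‖curl (v σ) x‖ ^ 2 + ε) ^ (q / 4) * (‖curl (v σ) x‖ ^ 2 + ε) ^ (q / 4) =
        (‖curl (v σ) x‖ ^ 2 + ε) ^ (q / 2) := by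
      rw [← Real.rpow_add hden]; ring_nf
    calc _ = q / 2 * Θ σ x ^ 2 * ((‖curl (v σ) x‖ ^ 2 + ε) ^ (q / 4 - 1) * (‖curl (v σ) x‖ ^ 2 + ε) ^ (q / 4)) *
          ⟪curl (v σ) x, fderiv ℝ (v σ) x (curl (v σ) x)⟫ +
        Θ σ x * ((‖curl (v σ) x‖ ^ 2 + ε) ^ (q / 4) * (‖curl (v σ) x‖ ^ 2 + ε) ^ (q / 4)) *
          (FluidPDE.timeDerivWithin (Icc 0 T) Θ σ x + fderiv ℝ (Θ σ) x (v σ x)) := by ring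
      _ = _ := by rw [e1, e2]
  simp only [hsq, hsrc] at hid
  exact hid

end QPow

end Summit.NavierStokesRegularity.NavierStokesRegularity.Theorems.PowerGaugeEulerLiouville.VorticityDecay

end
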